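import Summits.QuantumFields.YangMills.Theorems.UnitScaleTiltProp7TrueLinIterSharpFibreT3
import Summits.QuantumFields.YangMills.Theorems.UnitScaleTiltProp7LinAvgDefectLetters
import Summits.QuantumFields.YangMills.Theorems.UnitScaleTiltProp7JointRowOfSuppliers
import Summits.QuantumFields.YangMills.Theorems.UnitScaleTiltProp7CoclosedEnergiesOfHKgK
import Summits.QuantumFields.YangMills.Theorems.UnitScaleTiltProp7UntwistedChartOfBlend
import HarnessLib

/-!
# Route `UnitScaleTilt`, crux K1 «MinimiserStabilityRegPr» (stmt-QuantumFields-19200), route-R E′ S3, ROW (P′) — THE DEFECT ROW `hq` AT THE MEMBER: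
# for an EXACT fibre point `Y ∈ 𝔅_k(V)∩(6)(e)` of an `(6)(e)∩𝔅_k(V)` background `W` with sup chart `‖Y(b)W(b)⁻¹ − 1‖ ≤ sQ·ℓ⁻¹` and `D := −i·log(YW⁻¹)`,
# `Σ_c‖Q^{(K−n)}_W D(c)‖² ≤ 1.5·10¹⁹·L¹⁸·sQ²·ℓ⁻¹·Σ‖D‖² + 2.4·10²²·L²⁰·sQ²·ℓ·(K(D) + DIV(D))` — second order in `sQ`, k- and volume-uniform

Cell `ym3-torus`, D-0154 (3c) twin-width seat `ym-routeR-w2` (gen 6); ★p1 g16 NAMER WORD 6 (ii) «hq DEFECT ROW» (2026-08-28 23:39Z: «ONE file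
`…Prop7LinAvgDefectOfExactFibrePoint.lean`»), w4-19200 g7 first-refusal pass (23:43Z), WORD 10 RULING (23:55Z: «book hq as `4N·Σ_c‖Q^{(K−n)}D c‖² ≤ θ_q·ℓ⁻¹·M + ζ_q·ℓ·K + η_q·ℓ·DIV(D)`,
`θ_q = 4N·A_M·sQ²`, `ζ_q = η_q = 4N·A_K·sQ²`; (P′) = (P) + absorbed `η·ℓ·DIV` slot», door v2 ✓ `Prop7ZetaRowOfEngineRowsAbs`); LOCATE `ym-routeR-w2/LOCATE-HQ-DEFECT-routeRw2g6.md`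
(19200 evidence).  THEOREMS ONLY (0 `def`, 0 `sorry`); `--supports stmt-QuantumFields-19200`, count-neutral.  YM₃ on T³ is a ladder rung (R3), not the Clay problem; nothing here
claims the stub, the crux, E′, d = 4 or the mass gap; (P′) is NOT closed by this file — it supplies ONE of its displayed rows.

THE POINT.  In the (P′) knit of the K-form engine (R3′ door ✓ `Prop7CovFaceFluxRow.sum_normSq_centreDiff_le_of_rows` over R2′ ✓ `covConstraintSplit_coclosed_T3`) the constraint value
`q := Q^{(K−n)}_W D` of the chart of the competitor's fibre representative enters as `4N·Σ_c‖q c‖²`.  `Y` and `W` lie on the SAME (0.4)-fibre, so the true linearised average of the chart is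
second order «pointwise along the averaging paths» (the namer's LOCATE): ★routeR-w3's `Q`-junction files B∕C bound it by sums in which every term carries the two-block sup `μ_i` of a
level ratio, and file A2 ✓ `Prop7TrueLinIterSharpFibreT3.sum_normSq_trueLinIter_le_sharp_LOnly_T3` keeps that factor to the end (`θ²` on both terms).  This file letters it at the E′
member: the chart dictionary (`e^{iD}W = Y`, `D` Hermitian traceless, `‖D b‖ ≤ 2sQℓ⁻¹`; ✓ `expHerm_hermLog` etc.), the background rows from `(6)(e)` (✓ `dist1_plaqHol_le_of_mem_regFibrePr`,
✓ `iter_eq_of_mem_fibre`), the sups `μ_j = 240L⁴Lʲ·sQ·ℓ⁻¹` hence `θ = 1872000·L⁷·sQ` (✓ `twoBlockMass_le_of_plaqBound_T3`), the currencies (✓ `currency_junction`: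
`M₀ ≤ 2M`, `CURL₀ + DIV₀ ≤ 8(K + DIV) + …`), and the junction `Q D = −i·Q(YW* − 1) + i·Q(Z′)`, `Z′ := (YW* − 1) − iD`, `‖Z′ b‖ ≤ ‖D b‖²` (✓ `norm_pertVar_sub_lin_le`, linearity
✓ `trueLinIter_sub ∕ _smul`) through file B1's `ℓ²`-operator letter of `Q` for ANY bond field (✓ `Prop7LinAvgDefectLetters.sum_normSq_trueLinIter_le_mass_T3`: structure theorem + ★routeR-w2's `(H¹)*` row at the top level + stencil bounds).
OUTPUT: the three-slot shape of the ruling with `A_M = 1.5·10¹⁹·L¹⁸`, `A_K = 2.4·10²²·L²⁰` (the tree's numerals compounded; no sharpness attempted), `DIV(D)` in the R5 door's letter.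

WHAT IS PROVED (ns `…Theorems.Prop7LinAvgDefectOfExactFibrePoint`; T³, `SU(2)`).
* (file B1 ✓ `…Prop7LinAvgDefectLetters`: `sum_hs_curl_le_mass`, ★ `sum_normSq_trueLinIter_le_mass_T3` — the `ℓ²` letter of `Q` on ANY bond field; `twoBlock_number`,
  `member_numerals` — the scalar windows.)
* ★★★ `linAvgDefect_of_exactFibrePoint` — the member row, hypotheses = the E′ display's member letters (`W, Y ∈ regFibrePr F n K _ e V`, sup chart, `D = −I•mlog(YW⁻¹)` bondwise,
  `Q` with `hQ0 ∕ hQs` at background `W` VERBATIM ✓p666871); NO `IsCritR2`, NO `S_H` (the row is kinematic).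
HONEST SCOPE.  Bookkeeping over landed theorems; every analytic input is a cited tree theorem; nothing of [Balaban1985Averaging] ∕ [Balaban1985Variational] is asserted beyond them.

References: T. Bałaban, CMP 98 (1985) 17–51 [Balaban1985Averaging] (Prop. 3 (122)–(126) p.36, Prop. 4 (134)–(135) p.38, (19)–(21) p.21); CMP 95 (1984) 17–40 [Balaban1984PropagatorsI]
((1.18)–(1.20) pp.19–20); CMP 99 (1985) 389–434 [Balaban1985BackgroundPropagators] ((3.3)–(3.4) pp.390–391, (3.8) p.392, Thm 3.11 p.416); CMP 102 (1985) 277–309 [Balaban1985Variational]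
((14)–(15) p.280, (112) p.294, (116) p.295, Prop. 7 p.299).
-/

set_option autoImplicit false

noncomputable section

open scoped BigOperators Matrix.Norms.L2Operator Matrix

namespace Summit.QuantumFields.YangMills.Theorems.Prop7LinAvgDefectOfExactFibrePoint

open Literature.MathematicalPhysics.QuantumFieldTheory.Balaban1983to89
open Literature.MathematicalPhysics.QuantumFieldTheory.Balaban1983to89.T3ContinuumYM3Torus
open Literature.MathematicalPhysics.QuantumFieldTheory.Balaban1983to89.T3ConstrainedMinimiser (fibre)
open Literature.MathematicalPhysics.QuantumFieldTheory.Balaban1983to89.T3PrintedRegularMinimiser (RegPr regFibrePr mem_regFibrePr_iff)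
open Literature.MathematicalPhysics.QuantumFieldTheory.Balaban1983to89.T3SectALandauChart (emb15)
open Finset T4Continuum T4ReflectionCone BlockAveraging AveragingRT ExpMeanLog BlockAveragingEMLLinearised BlockAveragingEMLLinearisedBackground
  BlockAveragingEMLProp2 B1RG242Torus
open MatrixLog (mlog)
open B9Eq39Adjoint (curl divB)
open B10Eq27TorusAxialLog (holT unitsField toUField)
open B9TorusCalculus (torusT)
open Summit.QuantumFields.YangMills.Theorems.Prop7TPrint (expHerm expHermField)
open Summit.QuantumFields.YangMills.Theorems.Prop7UntwistedChartOfBlend (hermLog_isHermitian hermLog_trace norm_hermLog_le expHerm_hermLog)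
open Summit.QuantumFields.YangMills.Theorems.Prop7HolRatioPerStep (norm_coe_eq_one)
open Summit.QuantumFields.YangMills.Theorems.Prop7FibreLevelSupRowsT3 (twoBlockMass_le_of_plaqBound_T3 mu_letter_T3)
open Summit.QuantumFields.YangMills.Theorems.Prop7TrueLinIterSharpFibreT3 (sum_normSq_trueLinIter_le_sharp_LOnly_T3)
open Summit.QuantumFields.YangMills.Theorems.Prop7LinAvgDefectLetters (sum_normSq_trueLinIter_le_mass_T3 twoBlock_number member_numerals)
open Summit.QuantumFields.YangMills.Theorems.Prop7TrueLinPureGaugeIter (trueLinIter_sub trueLinIter_smul)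
open Summit.QuantumFields.YangMills.Theorems.Prop7CurvedLandauKnitT3 (three_le_L)
open Summit.QuantumFields.YangMills.Theorems.Prop7HessWOfFibreCoreT3Rows (norm_pertVar_sub_lin_le)
open Summit.QuantumFields.YangMills.Theorems.Prop7JointRowOfSuppliers (currency_junction)
open Summit.QuantumFields.YangMills.Theorems.Prop7CoclosedEnergiesOfHKgK (dist1_plaqHol_le_of_mem_regFibrePr)
open Summit.QuantumFields.YangMills.Theorems.Prop7AxialLemma1 (iter_eq_of_mem_fibre)

/-! ## ★★★ The defect row at the E′ member -/

set_option maxHeartbeats 400000 in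
/-- ★★★ **THE DEFECT ROW `hq` OF (P′) AT THE E′ MEMBER.**  `F` a T³ family, `n < K`, `0 < e`, `10¹⁴L⁹e ≤ 1`; `W, Y ∈ (6)(e) ∩ 𝔅_k(V)` (`regFibrePr`; in the E′ display `W` is the
R2-critical background and `Y` the competitor's exactly `S_H`-gauged fibre representative — neither criticality nor the gauge is used here); sup chart `‖Y(b)W(b)⁻¹ − 1‖ ≤ sQ·ℓ⁻¹`
(`ℓ = L^{K−n}`) with `0 ≤ sQ`, `8·10¹¹L⁹sQ ≤ 1`; `D = −i·log(YW⁻¹)` bondwise; `Q` the true linearised iterate at background `W` (`hQ0`, `hQs` VERBATIM).  THEN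
`Σ_c‖Q (K−n) D c‖² ≤ 1.5·10¹⁹·L¹⁸·sQ²·ℓ⁻¹·Σ_b‖D b‖² + 2.4·10²²·L²⁰·sQ²·ℓ·(K(D) + DIV(D))` with `K(D) = Σ_p‖ℒ_p(D)‖²` the E′ display's K-letter and
`DIV(D) = Σ_xΣ_jk‖(D*_W(i·D))(x)_jk‖²` the R5 door's DIV letter (✓ `Prop7ZetaRowOfEngineRowsAbs`).  The namer's `θ_q ℓ⁻¹M + ζ_q ℓK + η_q ℓDIV` with `θ_q∕4N = 1.5·10¹⁹L¹⁸sQ²`,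
`ζ_q∕4N = η_q∕4N = 2.4·10²²L²⁰sQ²`.
[cite: Balaban1985Averaging, Prop. 3 (122)-(126) p.36, Prop. 4 (134)-(135) p.38, (19)-(21) p.21; Balaban1984PropagatorsI, (1.18)-(1.20) pp.19-20; Balaban1985BackgroundPropagators, Thm 3.11 p.416, (3.3)-(3.4) pp.390-391; Balaban1985Variational, (14)-(15) p.280, (112) p.294, Prop. 7 p.299] -/
theorem linAvgDefect_of_exactFibrePoint (F : T3Family) {n K : ℕ} (hnK : n < K) {e : ℝ} (he : 0 < e)
    (heL : 100000000000000 * (F.L : ℝ) ^ 9 * e ≤ 1)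
    {V : GaugeField (F.P n) 0 (Matrix.specialUnitaryGroup (Fin 2) ℂ)} {W Y : GaugeField (F.P K) 0 (Matrix.specialUnitaryGroup (Fin 2) ℂ)}
    (hW : W ∈ regFibrePr F n K hnK.le e V) (hY : Y ∈ regFibrePr F n K hnK.le e V)
    {sQ : ℝ} (hsQ0 : 0 ≤ sQ) (hsQL : 800000000000 * (F.L : ℝ) ^ 9 * sQ ≤ 1)
    (hsup : ∀ b : PBond (F.P K) 0, ‖((Y b * (W b)⁻¹ : Matrix.specialUnitaryGroup (Fin 2) ℂ) : Matrix (Fin 2) (Fin 2) ℂ) - 1‖ ≤ sQ * ((F.L : ℝ) ^ (K - n))⁻¹)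
    (D : PBond (F.P K) 0 → Matrix (Fin 2) (Fin 2) ℂ)
    (hD : D = fun b => (-Complex.I) • mlog ((Y b * (W b)⁻¹ : Matrix.specialUnitaryGroup (Fin 2) ℂ) : Matrix (Fin 2) (Fin 2) ℂ))
    (Q : (k : ℕ) → (PBond (F.P K) 0 → Matrix (Fin 2) (Fin 2) ℂ) → PBond (F.P K) k → Matrix (Fin 2) (Fin 2) ℂ) (hQ0 : ∀ Y, Q 0 Y = Y)
    (hQs : ∀ (k : ℕ) (Y : PBond (F.P K) 0 → Matrix (Fin 2) (Fin 2) ℂ) (c : PBond (F.P K) (k + 1)), Q (k + 1) Y c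
      = (fderiv ℂ (eml : (Idx (F.P K) → Matrix (Fin 2) (Fin 2) ℂ) → Matrix (Fin 2) (Fin 2) ℂ)
            (fun i => ((loopHol (Averaging.iter (fun i => blockAvg (P := (F.P K)) (j := i) (expMeanLogSU (n := Fin 2))) k W) c i : Matrix.specialUnitaryGroup (Fin 2) ℂ) : Matrix (Fin 2) (Fin 2) ℂ))
            (fun i => covWalkSum (Averaging.iter (fun i => blockAvg (P := (F.P K)) (j := i) (expMeanLogSU (n := Fin 2))) k W) (Q k Y) (walk (emb c.src) (loopWord (F.P K).L c.dir (off i.1) i.2.1 i.2.2))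
              * ((loopHol (Averaging.iter (fun i => blockAvg (P := (F.P K)) (j := i) (expMeanLogSU (n := Fin 2))) k W) c i : Matrix.specialUnitaryGroup (Fin 2) ℂ) : Matrix (Fin 2) (Fin 2) ℂ))
            * star ((corr (expMeanLogSU (n := Fin 2)) (Averaging.iter (fun i => blockAvg (P := (F.P K)) (j := i) (expMeanLogSU (n := Fin 2))) k W) c : Matrix.specialUnitaryGroup (Fin 2) ℂ) : Matrix (Fin 2) (Fin 2) ℂ)
          + ((corr (expMeanLogSU (n := Fin 2)) (Averaging.iter (fun i => blockAvg (P := (F.P K)) (j := i) (expMeanLogSU (n := Fin 2))) k W) c : Matrix.specialUnitaryGroup (Fin 2) ℂ) : Matrix (Fin 2) (Fin 2) ℂ)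
            * covWalkSum (Averaging.iter (fun i => blockAvg (P := (F.P K)) (j := i) (expMeanLogSU (n := Fin 2))) k W) (Q k Y) (walk (emb c.src) (List.replicate (F.P K).L (c.dir, true)))
            * star ((corr (expMeanLogSU (n := Fin 2)) (Averaging.iter (fun i => blockAvg (P := (F.P K)) (j := i) (expMeanLogSU (n := Fin 2))) k W) c : Matrix.specialUnitaryGroup (Fin 2) ℂ) : Matrix (Fin 2) (Fin 2) ℂ))) :
    ∑ c : PBond (F.P K) (K - n), ‖Q (K - n) D c‖ ^ 2
      ≤ 15000000000000000000 * (F.L : ℝ) ^ 18 * sQ ^ 2 * ((F.L : ℝ) ^ (K - n))⁻¹ * (∑ b : PBond (F.P K) 0, ‖D b‖ ^ 2)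
        + 24000000000000000000000 * (F.L : ℝ) ^ 20 * sQ ^ 2 * ((F.L : ℝ) ^ (K - n))
          * ((∑ p : Plaq (F.P K) 0, ‖((Complex.I • D ⟨p.src, p.μ⟩) + ((W ⟨p.src, p.μ⟩ : Matrix (Fin 2) (Fin 2) ℂ) * (Complex.I • D ⟨p.src.shift p.μ, p.ν⟩) * star (W ⟨p.src, p.μ⟩ : Matrix (Fin 2) (Fin 2) ℂ))
            - (((W ⟨p.src, p.μ⟩ * W ⟨p.src.shift p.μ, p.ν⟩ * (W ⟨p.src.shift p.ν, p.μ⟩)⁻¹ : Matrix.specialUnitaryGroup (Fin 2) ℂ) : Matrix (Fin 2) (Fin 2) ℂ) * (Complex.I • D ⟨p.src.shift p.ν, p.μ⟩) * star ((W ⟨p.src, p.μ⟩ * W ⟨p.src.shift p.μ, p.ν⟩ * (W ⟨p.src.shift p.ν, p.μ⟩)⁻¹ : Matrix.specialUnitaryGroup (Fin 2) ℂ) : Matrix (Fin 2) (Fin 2) ℂ))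
            - (((GaugeField.plaqHol W p : Matrix.specialUnitaryGroup (Fin 2) ℂ) : Matrix (Fin 2) (Fin 2) ℂ) * (Complex.I • D ⟨p.src, p.ν⟩) * star ((GaugeField.plaqHol W p : Matrix.specialUnitaryGroup (Fin 2) ℂ) : Matrix (Fin 2) (Fin 2) ℂ)))‖ ^ 2)
            + (∑ x : Site (F.P K) 0, ∑ j : Fin 2, ∑ k : Fin 2,
            ‖(divB (torusT (F.P K) 0) (fun κ z => unitsField (toUField W) ⟨z, κ⟩) (fun κ z => Complex.I • D ⟨z, κ⟩) x) j k‖ ^ 2)) := by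
  -- T³ letters and windows
  have hL3 := three_le_L F
  have hL0 : (0 : ℝ) < (F.L : ℝ) := by linarith only [hL3]
  have hL1 : (1 : ℝ) ≤ (F.L : ℝ) := by linarith only [hL3]
  have hℓ1 : (1 : ℝ) ≤ (F.L : ℝ) ^ (K - n) := one_le_pow₀ hL1
  have hℓ0 : (0 : ℝ) < (F.L : ℝ) ^ (K - n) := by linarith only [hℓ1]
  have hℓi0 : (0 : ℝ) ≤ ((F.L : ℝ) ^ (K - n))⁻¹ := by positivity
  have hℓi1 : ((F.L : ℝ) ^ (K - n))⁻¹ ≤ 1 := inv_le_one_of_one_le₀ hℓ1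
  have hL9 : (1 : ℝ) ≤ (F.L : ℝ) ^ 9 := one_le_pow₀ hL1
  have hsQ1 : sQ ≤ 1 / 800000000000 := by
    have hu : (F.L : ℝ) ^ 9 * sQ ≤ 1 / 800000000000 := by linarith [hsQL]
    linarith [hu, mul_le_mul_of_nonneg_right hL9 hsQ0]
  have heL' : 1000000 * (F.L : ℝ) ^ 5 * e ≤ 1 := by
    have h59 : (F.L : ℝ) ^ 5 ≤ (F.L : ℝ) ^ 9 := pow_le_pow_right₀ hL1 (by norm_num)
    nlinarith [h59, he.le]
  have hsℓ : sQ * ((F.L : ℝ) ^ (K - n))⁻¹ ≤ sQ := by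
    have := mul_le_mul_of_nonneg_left hℓi1 hsQ0
    rwa [mul_one] at this
  -- the chart `Q_b = Y_b W_b⁻¹`, within `1∕3` of `1`; `D` Hermitian traceless, `‖D b‖ ≤ 2sQℓ⁻¹`; `e^{iD}W = Y`
  have hthird : ∀ b : PBond (F.P K) 0, ‖((Y b * (W b)⁻¹ : Matrix.specialUnitaryGroup (Fin 2) ℂ) : Matrix (Fin 2) (Fin 2) ℂ) - 1‖ ≤ 1 / 3 :=
    fun b => (hsup b).trans (hsℓ.trans (by linarith))
  have hDb : ∀ b : PBond (F.P K) 0, D b = (-Complex.I) • mlog ((Y b * (W b)⁻¹ : Matrix.specialUnitaryGroup (Fin 2) ℂ) : Matrix (Fin 2) (Fin 2) ℂ) :=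
    fun b => by rw [hD]
  have hDh : ∀ b : PBond (F.P K) 0, (D b).IsHermitian ∧ Matrix.trace (D b) = 0 := fun b => by
    have hQb := Matrix.mem_specialUnitaryGroup_iff.1 (Y b * (W b)⁻¹).2
    rw [hDb b]
    exact ⟨hermLog_isHermitian hQb.1 (hthird b), hermLog_trace hQb.2 (hthird b)⟩
  have hDs : ∀ b : PBond (F.P K) 0, ‖D b‖ ≤ 2 * sQ * ((F.L : ℝ) ^ (K - n))⁻¹ := fun b => by
    rw [hDb b]
    calc ‖(-Complex.I) • mlog ((Y b * (W b)⁻¹ : Matrix.specialUnitaryGroup (Fin 2) ℂ) : Matrix (Fin 2) (Fin 2) ℂ)‖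
        ≤ 2 * ‖((Y b * (W b)⁻¹ : Matrix.specialUnitaryGroup (Fin 2) ℂ) : Matrix (Fin 2) (Fin 2) ℂ) - 1‖ := norm_hermLog_le ((hthird b).trans (by norm_num))
      _ ≤ 2 * (sQ * ((F.L : ℝ) ^ (K - n))⁻¹) := by linarith [hsup b]
      _ = 2 * sQ * ((F.L : ℝ) ^ (K - n))⁻¹ := by ring
  have hcfg : emb15 W (expHermField D) = Y := by
    funext b
    show expHerm (D b) * W b = Y b
    rw [hDb b, expHerm_hermLog (Y b * (W b)⁻¹) (hthird b), inv_mul_cancel_right]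
  -- background plaquettes from `(6)(e)`, the common fibre
  have hU := dist1_plaqHol_le_of_mem_regFibrePr F hnK.le hW
  have hfib : Averaging.iter (fun i => blockAvg (P := (F.P K)) (j := i) (expMeanLogSU (n := Fin 2))) (K - n) Y
      = Averaging.iter (fun i => blockAvg (P := (F.P K)) (j := i) (expMeanLogSU (n := Fin 2))) (K - n) W :=
    iter_eq_of_mem_fibre F hnK.le ((mem_regFibrePr_iff F).mp hY).1 ((mem_regFibrePr_iff F).mp hW).1
  -- bondwise closeness `‖Y_b − W_b‖ ≤ sQℓ⁻¹`
  have hρb : ∀ b : PBond (F.P K) 0, ‖((Y b : Matrix.specialUnitaryGroup (Fin 2) ℂ) : Matrix (Fin 2) (Fin 2) ℂ) - ((W b : Matrix.specialUnitaryGroup (Fin 2) ℂ) : Matrix (Fin 2) (Fin 2) ℂ)‖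
      ≤ sQ * ((F.L : ℝ) ^ (K - n))⁻¹ := fun b => by
    have e1 : ((Y b : Matrix.specialUnitaryGroup (Fin 2) ℂ) : Matrix (Fin 2) (Fin 2) ℂ) - ((W b : Matrix.specialUnitaryGroup (Fin 2) ℂ) : Matrix (Fin 2) (Fin 2) ℂ)
        = (((Y b * (W b)⁻¹ : Matrix.specialUnitaryGroup (Fin 2) ℂ) : Matrix (Fin 2) (Fin 2) ℂ) - 1) * ((W b : Matrix.specialUnitaryGroup (Fin 2) ℂ) : Matrix (Fin 2) (Fin 2) ℂ) := by
      have hm : (((Y b * (W b)⁻¹ : Matrix.specialUnitaryGroup (Fin 2) ℂ)) : Matrix (Fin 2) (Fin 2) ℂ) * ((W b : Matrix.specialUnitaryGroup (Fin 2) ℂ) : Matrix (Fin 2) (Fin 2) ℂ)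
          = ((Y b : Matrix.specialUnitaryGroup (Fin 2) ℂ) : Matrix (Fin 2) (Fin 2) ℂ) := by
        rw [← Submonoid.coe_mul, inv_mul_cancel_right]
      rw [sub_mul, one_mul, hm]
    rw [e1]
    exact (norm_mul_le _ _).trans (by rw [norm_coe_eq_one, mul_one]; exact hsup b)
  -- the two-block sups `μ_j = 240·L⁴·Lʲ·sQ·ℓ⁻¹`
  have hδ : deltaSU (Fin 2) = 1 / 3 := by
    unfold deltaSU
    rw [Fintype.card_fin]
    refine min_eq_left ?_
    rw [le_div_iff₀ (by norm_num)]
    have := Real.pi_gt_three; push_cast; linarith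
  have hd : (F.P K).d = 3 := T3Family.P_d F K
  have hLF : (F.P K).L = F.L := rfl
  have hm := F.hm
  have hμ : ∀ j < K - n, ∀ c : PBond (F.P K) (j + 1),
      ((((F.P K).d + 2) * (F.P K).L : ℕ) : ℝ) * ∑ b ∈ (univ.filter (fun b : PBond (F.P K) j => blockOf b.src = c.src ∨ blockOf b.src = c.tgt)),
          ‖(pertVar (Averaging.iter (fun i => blockAvg (P := (F.P K)) (j := i) (expMeanLogSU (n := Fin 2))) j W)
            (Averaging.iter (fun i => blockAvg (P := (F.P K)) (j := i) (expMeanLogSU (n := Fin 2))) j Y)) b‖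
        ≤ (fun j : ℕ => 240 * (F.L : ℝ) ^ 4 * (F.L : ℝ) ^ j * (sQ * ((F.L : ℝ) ^ (K - n))⁻¹)) j := by
    intro j hj c
    have hnum := twoBlock_number (j := j) (k := K - n) hL3 hj hsQ0 hsQL he.le heL
    have h := twoBlockMass_le_of_plaqBound_T3 F K (j := j) (by show j + 1 < F.m + K; omega) c Y W (by positivity) (by positivity) hU hρb
      hnum
    refine h.trans (le_of_eq ?_)
    rw [mu_letter_T3, hd, hLF]; push_cast; ring
  have hμ0 : ∀ j < K - n, 0 ≤ (fun j : ℕ => 240 * (F.L : ℝ) ^ 4 * (F.L : ℝ) ^ j * (sQ * ((F.L : ℝ) ^ (K - n))⁻¹)) j := fun j _ => by positivity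
  -- `Lʲ·ℓ⁻¹ ≤ 1` for `j < K − n`, hence `μ_j ≤ 240L⁴sQ`
  have hμsmall : ∀ j < K - n, (fun j : ℕ => 240 * (F.L : ℝ) ^ 4 * (F.L : ℝ) ^ j * (sQ * ((F.L : ℝ) ^ (K - n))⁻¹)) j ≤ 240 * (F.L : ℝ) ^ 4 * sQ := by
    intro j hj
    have hjk : (F.L : ℝ) ^ j ≤ (F.L : ℝ) ^ (K - n) := pow_le_pow_right₀ hL1 hj.le
    have hA : (F.L : ℝ) ^ j * ((F.L : ℝ) ^ (K - n))⁻¹ ≤ 1 := by rw [← div_eq_mul_inv, div_le_one hℓ0]; exact hjk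
    have h0 : 0 ≤ 240 * (F.L : ℝ) ^ 4 * sQ := by positivity
    have := mul_le_mul_of_nonneg_left hA h0
    show 240 * (F.L : ℝ) ^ 4 * (F.L : ℝ) ^ j * (sQ * ((F.L : ℝ) ^ (K - n))⁻¹) ≤ 240 * (F.L : ℝ) ^ 4 * sQ
    nlinarith [this]
  have hL4sQ : 240 * (F.L : ℝ) ^ 4 * sQ ≤ 1 / 1000 := by
    have h49 : (F.L : ℝ) ^ 4 ≤ (F.L : ℝ) ^ 9 := pow_le_pow_right₀ hL1 (by norm_num)
    nlinarith [h49, hsQL, hsQ0]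
  have hμ72 : ∀ j < K - n, 72 * (fun j : ℕ => 240 * (F.L : ℝ) ^ 4 * (F.L : ℝ) ^ j * (sQ * ((F.L : ℝ) ^ (K - n))⁻¹)) j ≤ 1 :=
    fun j hj => by linarith [hμsmall j hj, hL4sQ]
  have hμN : ∀ j < K - n, 3 * (fun j : ℕ => 240 * (F.L : ℝ) ^ 4 * (F.L : ℝ) ^ j * (sQ * ((F.L : ℝ) ^ (K - n))⁻¹)) j + 1 / 24 < deltaSU (Fin 2) :=
    fun j hj => by rw [hδ]; linarith [hμsmall j hj, hL4sQ]
  have hθ0 : (0 : ℝ) ≤ 1872000 * (F.L : ℝ) ^ 7 * sQ := by positivity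
  have hμθ : ∀ j < K - n, 7800 * (F.L : ℝ) ^ 3 * (F.L : ℝ) ^ (K - n) * (fun j : ℕ => 240 * (F.L : ℝ) ^ 4 * (F.L : ℝ) ^ j * (sQ * ((F.L : ℝ) ^ (K - n))⁻¹)) j
      ≤ (1872000 * (F.L : ℝ) ^ 7 * sQ) * (F.L : ℝ) ^ j := by
    intro j _
    have hℓℓ : (F.L : ℝ) ^ (K - n) * ((F.L : ℝ) ^ (K - n))⁻¹ = 1 := mul_inv_cancel₀ hℓ0.ne'
    show 7800 * (F.L : ℝ) ^ 3 * (F.L : ℝ) ^ (K - n) * (240 * (F.L : ℝ) ^ 4 * (F.L : ℝ) ^ j * (sQ * ((F.L : ℝ) ^ (K - n))⁻¹)) ≤ (1872000 * (F.L : ℝ) ^ 7 * sQ) * (F.L : ℝ) ^ j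
    have e1 : 7800 * (F.L : ℝ) ^ 3 * (F.L : ℝ) ^ (K - n) * (240 * (F.L : ℝ) ^ 4 * (F.L : ℝ) ^ j * (sQ * ((F.L : ℝ) ^ (K - n))⁻¹))
        = (1872000 * (F.L : ℝ) ^ 7 * sQ) * (F.L : ℝ) ^ j * ((F.L : ℝ) ^ (K - n) * ((F.L : ℝ) ^ (K - n))⁻¹) := by ring
    rw [e1, hℓℓ, mul_one]
  have hθL : 1000 * (1872000 * (F.L : ℝ) ^ 7 * sQ) * (F.L : ℝ) ≤ 1 := by
    have h89 : (F.L : ℝ) ^ 8 ≤ (F.L : ℝ) ^ 9 := pow_le_pow_right₀ hL1 (by norm_num)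
    have e1 : 1000 * (1872000 * (F.L : ℝ) ^ 7 * sQ) * (F.L : ℝ) = 1872000000 * ((F.L : ℝ) ^ 8 * sQ) := by ring
    rw [e1]
    nlinarith [mul_le_mul_of_nonneg_right h89 hsQ0, hsQL]
  -- ★ the sharp budget (file A2) at `U₀ := W`, competitor `Y`, `θ := 1872000·L⁷·sQ`
  have hZP := sum_normSq_trueLinIter_le_sharp_LOnly_T3 F n K W Y he heL' hU hfib Q hQ0 hQs
    (fun j : ℕ => 240 * (F.L : ℝ) ^ 4 * (F.L : ℝ) ^ j * (sQ * ((F.L : ℝ) ^ (K - n))⁻¹)) hμ0 hμ hμ72 hμN hθ0 hμθ hθL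
  -- the currencies (✓ `currency_junction`), read at `e^{iD}W = Y`
  have hs4 : 4 * (2 * sQ * ((F.L : ℝ) ^ (K - n))⁻¹) ≤ 1 := by nlinarith [hsℓ, hsQ1]
  obtain ⟨hM₀, hCD⟩ := currency_junction F hs4 W hU D hDh hDs
  rw [hcfg] at hM₀ hCD
  -- the `Z′`-junction: `Z′ := (YW* − 1) − iD`, `‖Z′ b‖ ≤ ‖D b‖²`
  have hRb : ∀ b : PBond (F.P K) 0, ‖pertVar W Y b - Complex.I • D b‖ ≤ ‖D b‖ ^ 2 := fun b => by
    have h1 : ‖D b‖ ≤ 1 := (hDs b).trans (by nlinarith [hsℓ, hsQ1])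
    have := norm_pertVar_sub_lin_le W D b (hDh b) h1
    rwa [hcfg] at this
  have hRsum : ∑ b : PBond (F.P K) 0, ‖(fun b => pertVar W Y b - Complex.I • D b) b‖ ^ 2
      ≤ (2 * sQ * ((F.L : ℝ) ^ (K - n))⁻¹) ^ 2 * ∑ b : PBond (F.P K) 0, ‖D b‖ ^ 2 := by
    rw [Finset.mul_sum]
    refine Finset.sum_le_sum fun b _ => ?_
    have h1 : ‖pertVar W Y b - Complex.I • D b‖ ≤ (2 * sQ * ((F.L : ℝ) ^ (K - n))⁻¹) * ‖D b‖ := by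
      calc ‖pertVar W Y b - Complex.I • D b‖ ≤ ‖D b‖ ^ 2 := hRb b
        _ = ‖D b‖ * ‖D b‖ := sq _
        _ ≤ (2 * sQ * ((F.L : ℝ) ^ (K - n))⁻¹) * ‖D b‖ := mul_le_mul_of_nonneg_right (hDs b) (norm_nonneg _)
    have h0 : 0 ≤ ‖pertVar W Y b - Complex.I • D b‖ := norm_nonneg _
    have := pow_le_pow_left₀ h0 h1 2
    show ‖pertVar W Y b - Complex.I • D b‖ ^ 2 ≤ (2 * sQ * ((F.L : ℝ) ^ (K - n))⁻¹) ^ 2 * ‖D b‖ ^ 2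
    nlinarith [this]
  have hZR0 := sum_normSq_trueLinIter_le_mass_T3 F n K W he heL' hU Q hQ0 hQs (fun b => pertVar W Y b - Complex.I • D b)
  have hcoef0 : 0 ≤ 9 / 2 * ((F.L : ℝ) ^ (K - n))⁻¹ + 576000 * (F.L : ℝ) ^ 4 * ((F.L : ℝ) ^ (K - n)) + 96000000000 * (F.L : ℝ) ^ 9 * e * ((F.L : ℝ) ^ (K - n))⁻¹ := by
    positivity
  have hZR := hZR0.trans (mul_le_mul_of_nonneg_left hRsum hcoef0)
  -- linearity: `Q D = −i·(Q(YW* − 1) − Q(Z′))`, pointwise triangle inequality, squares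
  have hID : Complex.I • D = pertVar W Y - (fun b => pertVar W Y b - Complex.I • D b) := by
    funext b
    simp only [Pi.smul_apply, Pi.sub_apply, sub_sub_cancel]
  have hpt : ∀ c : PBond (F.P K) (K - n), ‖Q (K - n) D c‖ ≤ ‖Q (K - n) (pertVar W Y) c‖ + ‖Q (K - n) (fun b => pertVar W Y b - Complex.I • D b) c‖ := by
    intro c
    have h1 : Q (K - n) (Complex.I • D) c = Complex.I • Q (K - n) D c := trueLinIter_smul W Q hQ0 hQs (K - n) Complex.I D c
    have h2 : Q (K - n) (Complex.I • D) c = Q (K - n) (pertVar W Y) c - Q (K - n) (fun b => pertVar W Y b - Complex.I • D b) c := by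
      rw [hID]; exact trueLinIter_sub W Q hQ0 hQs (K - n) (pertVar W Y) (fun b => pertVar W Y b - Complex.I • D b) c
    calc ‖Q (K - n) D c‖ = ‖Complex.I • Q (K - n) D c‖ := by rw [norm_smul, Complex.norm_I, one_mul]
      _ = ‖Q (K - n) (pertVar W Y) c - Q (K - n) (fun b => pertVar W Y b - Complex.I • D b) c‖ := by rw [← h1, h2]
      _ ≤ ‖Q (K - n) (pertVar W Y) c‖ + ‖Q (K - n) (fun b => pertVar W Y b - Complex.I • D b) c‖ := norm_sub_le _ _
  have hsq : ∑ c : PBond (F.P K) (K - n), ‖Q (K - n) D c‖ ^ 2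
      ≤ 2 * ∑ c : PBond (F.P K) (K - n), ‖Q (K - n) (pertVar W Y) c‖ ^ 2 + 2 * ∑ c : PBond (F.P K) (K - n), ‖Q (K - n) (fun b => pertVar W Y b - Complex.I • D b) c‖ ^ 2 := by
    rw [Finset.mul_sum, Finset.mul_sum, ← Finset.sum_add_distrib]
    refine Finset.sum_le_sum fun c _ => ?_
    have h := pow_le_pow_left₀ (norm_nonneg _) (hpt c) 2
    nlinarith [h, sq_nonneg (‖Q (K - n) (pertVar W Y) c‖ - ‖Q (K - n) (fun b => pertVar W Y b - Complex.I • D b) c‖)]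
  -- the numerals
  have hM0 : 0 ≤ ∑ b : PBond (F.P K) 0, ‖D b‖ ^ 2 := Finset.sum_nonneg fun _ _ => sq_nonneg _
  have hM₀0 : 0 ≤ ∑ b : PBond (F.P K) 0, ‖pertVar W Y b‖ ^ 2 := Finset.sum_nonneg fun _ _ => sq_nonneg _
  have hKD : 0 ≤ (∑ p : Plaq (F.P K) 0, ‖((Complex.I • D ⟨p.src, p.μ⟩) + ((W ⟨p.src, p.μ⟩ : Matrix (Fin 2) (Fin 2) ℂ) * (Complex.I • D ⟨p.src.shift p.μ, p.ν⟩) * star (W ⟨p.src, p.μ⟩ : Matrix (Fin 2) (Fin 2) ℂ))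
            - (((W ⟨p.src, p.μ⟩ * W ⟨p.src.shift p.μ, p.ν⟩ * (W ⟨p.src.shift p.ν, p.μ⟩)⁻¹ : Matrix.specialUnitaryGroup (Fin 2) ℂ) : Matrix (Fin 2) (Fin 2) ℂ) * (Complex.I • D ⟨p.src.shift p.ν, p.μ⟩) * star ((W ⟨p.src, p.μ⟩ * W ⟨p.src.shift p.μ, p.ν⟩ * (W ⟨p.src.shift p.ν, p.μ⟩)⁻¹ : Matrix.specialUnitaryGroup (Fin 2) ℂ) : Matrix (Fin 2) (Fin 2) ℂ))
            - (((GaugeField.plaqHol W p : Matrix.specialUnitaryGroup (Fin 2) ℂ) : Matrix (Fin 2) (Fin 2) ℂ) * (Complex.I • D ⟨p.src, p.ν⟩) * star ((GaugeField.plaqHol W p : Matrix.specialUnitaryGroup (Fin 2) ℂ) : Matrix (Fin 2) (Fin 2) ℂ)))‖ ^ 2)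
            + (∑ x : Site (F.P K) 0, ∑ j : Fin 2, ∑ k : Fin 2,
            ‖(divB (torusT (F.P K) 0) (fun κ z => unitsField (toUField W) ⟨z, κ⟩) (fun κ z => Complex.I • D ⟨z, κ⟩) x) j k‖ ^ 2) := by positivity
  have hnum := member_numerals hL3 hℓ1 hsQ0 hsQL he.le heL hM0 hKD hM₀0 hM₀ hCD hZP hZR
  linarith [hsq, hnum]

end Summit.QuantumFields.YangMills.Theorems.Prop7LinAvgDefectOfExactFibrePoint

end
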